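import Mathlib
import Literature.Topology.FourManifolds.LickorishWallaceLeaves
import Literature.Topology.FourManifolds.OneHandleStepExists
import Literature.Topology.FourManifolds.CorkDecomposition
import Literature.Topology.FourManifolds.SPC4HandlesProofs
import Literature.Topology.FourManifolds.SmaleDiffDisc
import HarnessLib

/-!
# HandlebodyKernelExtension

Topic `Literature/Topology/FourManifolds`. Named literature fact(s) relocated by the gate from `Summits/SmoothPoincare4/SmoothPoincare4/Theorems/CongruenceShadowsAgkCor6SufficiencyStubHandlebodyExtension.lean`
(accept-time relocation of `[cite]`d propositions written inline in a Summits proposal; human ruling 2026-08-15).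
Sources: GriffithsHB1964Handlebody.

* `Literature.Topology.FourManifolds.GriffithsExtension`
-/

namespace Literature.Topology.FourManifolds

open Set Function
open scoped _root_.Manifold _root_.ContDiff _root_.Topology
open Literature.Topology.FourManifolds

/-- **Griffiths' theorem, extension form** (the classical input of handlebody extension; NOT
asserted here — it is the line's delegated fact `stub_griffiths` and the hypothesis of
`stub_handlebodyExtension`).  For a genus-`g` handlebody `H` (`IsHandlebody g H`: compact,
connected, orientable, one `0`-handle and `g` `1`-handles) with boundary datum `b`, a
self-diffeomorphism `ψ` of `∂H` whose induced map on `π₁(∂H, x₀)` carries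
`ker (π₁ ∂H → π₁ H)` (at `x₀`) onto the same kernel (at `ψ x₀`) extends to a self-diffeomorphism
of `H` (`BoundaryData.DiffeoExtends`: `∃ Ψ : H ≅ H, Ψ ∘ incl = incl ∘ ψ`).  H. B. Griffiths,
*Automorphisms of a 3-dimensional handlebody*, Abh. Math. Sem. Univ. Hamburg 26 (1964) 191–210,
main theorem: the image of the group of homeomorphisms of `H` in the mapping class group of `∂H`
is the stabiliser of `ker (π₁ ∂H → π₁ H)`, i.e. a homeomorphism of `∂H` extends over `H` iff it
preserves that kernel (restated: D. McCullough, A. Miller, *Homeomorphisms of 3-manifolds with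
compressible boundary*, Mem. AMS 344 (1986), §1; S. Hensel, *A primer on handlebody groups*,
Handbook of group actions V (2020): a mapping class of `∂V` extends over `V` iff it preserves the
meridians, by Dehn's lemma).  Smooth, exact-restriction form of the printed (PL / topological,
up-to-isotopy) statement: homeomorphisms of compact surfaces and of handlebodies are isotopic to
diffeomorphisms, and an extension that restricts to a map isotopic to `ψ` is corrected to one
restricting to `ψ` exactly by absorbing the isotopy in a collar of `∂H`.  The kernel condition is
necessary (functoriality of `π₁` along `Ψ ∘ incl = incl ∘ ψ`), so this is an `iff`.
-- TODO(general form): Griffiths determines the full image of `Homeo(H) → MCG(∂H)` (the stabiliser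
-- of the kernel); only the extension criterion for a single boundary diffeomorphism is stated.
[cite: GriffithsHB1964Handlebody, main theorem] [file Topology/FourManifolds/HandlebodyKernelExtension] -/
def GriffithsExtension : Prop :=
  ∀ (g : ℕ) (H : Type) [TopologicalSpace H] [T2Space H] [SecondCountableTopology H]
    [ChartedSpace (EuclideanHalfSpace 3) H] [IsManifold (𝓡∂ 3) ∞ H]
    (_ : IsHandlebody g H) (b : BoundaryData (𝓡∂ 3) H (𝓡 2))
    (ψ : b.carrier ≃ₘ⟮𝓡 2, 𝓡 2⟯ b.carrier) (x₀ : b.carrier),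
    ((FundamentalGroup.map (⟨b.incl, b.continuous_incl⟩ : C(b.carrier, H)) x₀).ker).map
        (FundamentalGroup.map (⟨ψ, ψ.continuous⟩ : C(b.carrier, b.carrier)) x₀)
      = (FundamentalGroup.map (⟨b.incl, b.continuous_incl⟩ : C(b.carrier, H))
          ((⟨ψ, ψ.continuous⟩ : C(b.carrier, b.carrier)) x₀)).ker →
    b.DiffeoExtends ψ

/-! ## The statement of the line (verbatim from the checked skeleton) -/

end Literature.Topology.FourManifolds
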